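import Mathlib.FieldTheory.Finite.Basic
import Mathlib.FieldTheory.Fixed
import Mathlib.LinearAlgebra.Lagrange
import Mathlib.LinearAlgebra.Basis.Defs
import Mathlib.Algebra.Polynomial.Eval.Degree
import HarnessLib

/-!
# Umans' augmented low-degree encoding (JCSS 2003, §4): degree along curves, the grid
# extension, and the Galois-equivariant augmentation

Literature / circuit complexity — derandomization. First mathematical layer of the tree's proof of
C. Umans, *Pseudo-random generators for all hardnesses*, J. Comput. System Sci. 67 (2003)
419–440, Thm. 6 (the generator behind Murray–Williams' Thm. 2.1, i.e. the structure
`UmansGenerator` of `MurrayWilliams2018SimulationProofs.lean`). This file is the ALGEBRA of §4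
("The encoding"), over an arbitrary field extension `L / K` (later: `K = 𝔽_q`, `L = 𝔽_{q^d}`):

* **Degree along curves** (`UmansEnc.curvePt`, `UmansEnc.CurveDeg D φ`): a parametrised curve of
  `L` with coefficient vectors `v₀, …, v_{n-1} ∈ L` is `t ↦ Σ_e tᵉ • v_e` (`t ∈ K`); a function
  `φ : L → K` has *degree `≤ D` along curves* if along every such curve it agrees with a univariate
  polynomial over `K` of degree `≤ D · (n - 1)`. This is the only consequence of "`φ` is a
  `d`-variate polynomial of total degree `≤ D` in the `K`-coordinates" that Umans' proof uses
  (§6.1: "`p(b) = π_j(G_x(αⁱ σᶜ C₁(b))_m)` is a degree `≤ r d h` univariate polynomial"), and it is a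
  calculus: closed under constants, `K`-linear functionals (degree `1`), sums, scalar multiples,
  products (degrees add), post-composition with a univariate polynomial of degree `≤ k` (degree
  `× k`) and PRE-COMPOSITION WITH `K`-LINEAR MAPS `L → L` (degree unchanged — the reason the proof
  can push the linear maps `u ↦ αⁱ u` and the Frobenius `σ` through), all proved
  (`CurveDeg.const/linear/add/smul/sum/mul/prod/comp_poly/comp_linearMap`).
* **The grid extension** (`UmansEnc.gridPt`, `UmansEnc.lde`; Umans Thm. 8 / eq. (2)): for a
  `K`-basis `B` of `L` indexed by `Fin d` and a finite node set `H ⊆ K`, the Lagrange extension of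
  a table `x : (Fin d → H) → K` on the grid `{Σ_i a_i • B_i : a ∈ H^d}`; it interpolates
  (`lde_gridPt`) and has degree `≤ d · (|H| - 1)` along curves (`curveDeg_lde`, property (P1));
  `UmansEnc.placedTable` places a string along given grid positions (property (P2) in the abstract:
  `lde_placedTable`).
* **The augmented encoding** (`UmansEnc.augE`; Umans Def. 9, Thm. 10): for `β ∈ L` and
  `φ : L → K`, `Ẽ(u) = Σ_{τ ∈ Gal(L/K)} φ(τ⁻¹ u) • τ(β)`. It is **equivariant** for the whole Galois
  group, `Ẽ(ρ u) = ρ(Ẽ(u))` (`augE_equivariant`, property (P3*) `σ Ẽ = Ẽ σ`); every `K`-linear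
  functional of `Ẽ` is a `K`-linear combination of the `φ ∘ τ⁻¹` and so keeps the degree along
  curves (`apply_augE`, `curveDeg_apply_augE`, property (P1*), for ANY `β`); and when
  `(τ β)_τ` is a (normal) basis `N`, the `N`-coordinates of `Ẽ(u)` are the `φ(τ⁻¹ u)`, in
  particular the coordinate at `τ = 1` reads `φ(u)` back (`coord_augE`, `coord_one_augE`,
  property (P2*)). Mathlib supplies normal bases of finite extensions of finite fields
  (`exists_linearIndependent_algEquiv_apply_of_finite`, `FieldTheory/Galois/NormalBasis.lean`).

## Faithfulness notes

* Umans' Def. 9 prints `LDẼ_x(y) = Σ_{j<d} LDE_x(σʲ y) β^{qʲ}` and Thm. 10 claims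
  `σ LDẼ_x = LDẼ_x σ`; with this sign the reindexing in the printed proof of (P3*) does not go
  through (`σ(Σ_j LDE(σʲy) β^{qʲ}) = Σ_j LDE(σ^{j-1}(σy))… ` needs `σ^{-j}`, not `σ^{j}`, against
  `β^{qʲ} = σʲ β`). The equivariant object is `Σ_j LDE(σ^{-j} y) σʲ(β)`, i.e. the sum over the
  Galois group of `φ(τ⁻¹ u) τ(β)` used here; all three properties (P1*)–(P3*) then hold as printed,
  and nothing else in the paper depends on the sign.
* "Total degree `≤ dh`" (P1) is rendered by its curve consequence `CurveDeg`; the printed degree of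
  the Lagrange extension with `|H| = h` nodes per coordinate is `d(h-1) ≤ dh`.
* The multiplicative structure of the grid (Umans' Lemma 7 / Thm. 8: `H = 𝔽_h`, the grid minus the
  origin a cyclic subgroup `{α^{rj}}`) is not used in this file; `placedTable` takes the positions
  abstractly. It enters with the concrete fields.

Everything is a definition with a body or a theorem; no named fact (D-0026).

## References

* C. Umans, *Pseudo-random generators for all hardnesses*, J. Comput. System Sci. 67 (2003)
  419–440, §3 (normal bases, Frobenius), §4 (Thm. 8, Def. 9, Thm. 10), §6.1 [Umans2003]
  (held text `paper:doi-10-1145-509907-509997`, pp. 424–428, checked).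
* R. Lidl, H. Niederreiter, *Finite Fields*, Encyclopedia Math. Appl. 20, CUP (2nd ed. 1997),
  Ch. 2 (structure of finite fields: Frobenius, normal bases) [LidlNiederreiter1996].
-/

noncomputable section

namespace Literature.Computability.Complexity

open Polynomial Finset

namespace UmansEnc

variable {K L : Type*} [Field K] [Field L] [Algebra K L]

/-! ### Curves and the degree of a function along curves -/

/-- **A parametrised curve of `L` over `K`** with coefficient vectors `v₀, …, v_{n-1}`:
`t ↦ Σ_e tᵉ • v_e` (a curve of degree `≤ n - 1`; in `K`-coordinates every coordinate is a
univariate polynomial of degree `≤ n - 1`). [cite: Umans2003, §6.1 ("degree `r` curves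
`C : 𝔽_q → 𝔽_q^d`")] -/
def curvePt {n : ℕ} (v : Fin n → L) (t : K) : L := ∑ e : Fin n, (t ^ (e : ℕ)) • v e

/-- **Degree `≤ D` along curves**: along every curve with `n` coefficient vectors, `φ` agrees with a
univariate polynomial over `K` of degree `≤ D (n - 1)`. [cite: Umans2003, §6.1 (the restriction of a
total-degree-`dh` polynomial to a degree-`r` curve is a degree `≤ r d h` univariate polynomial)] -/
def CurveDeg (D : ℕ) (φ : L → K) : Prop :=
  ∀ (n : ℕ) (v : Fin n → L), ∃ g : K[X], g.natDegree ≤ D * (n - 1) ∧ ∀ t : K, φ (curvePt v t) = g.eval t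

/-- A `K`-linear map pushes through a curve: `A(Σ tᵉ • v_e) = Σ tᵉ • A v_e`. [folklore] -/
theorem linearMap_curvePt {M : Type*} [AddCommMonoid M] [Module K M] {n : ℕ} (A : L →ₗ[K] M)
    (v : Fin n → L) (t : K) : A (curvePt v t) = ∑ e : Fin n, (t ^ (e : ℕ)) • A (v e) := by
  simp [curvePt, map_sum, map_smul]

namespace CurveDeg

variable {D D' : ℕ} {φ ψ : L → K}

/-- Weakening of the degree bound. [folklore] -/
theorem mono (h : CurveDeg D φ) (hD : D ≤ D') : CurveDeg D' φ := fun n v => by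
  obtain ⟨g, hg, hgv⟩ := h n v
  exact ⟨g, hg.trans (Nat.mul_le_mul_right _ hD), hgv⟩

/-- Constants have degree `0` along curves. [folklore] -/
theorem const (c : K) : CurveDeg (L := L) 0 (fun _ => c) := fun n v =>
  ⟨C c, by simp, fun t => by simp⟩

/-- **`K`-linear functionals have degree `1` along curves**: `λ(Σ tᵉ • v_e) = Σ λ(v_e) tᵉ`.
[folklore] -/
theorem linear (lam : L →ₗ[K] K) : CurveDeg 1 (fun u => lam u) := fun n v => by
  refine ⟨∑ e : Fin n, C (lam (v e)) * X ^ (e : ℕ), ?_, fun t => ?_⟩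
  · rw [one_mul]
    refine natDegree_sum_le_of_forall_le _ _ fun e _ => ?_
    refine (natDegree_C_mul_X_pow_le _ _).trans ?_
    have := e.2; omega
  · show lam (curvePt v t) = _
    rw [linearMap_curvePt, eval_finsetSum]
    refine sum_congr rfl fun e _ => ?_
    rw [eval_mul, eval_C, eval_pow, eval_X, smul_eq_mul, mul_comm]

/-- Sums. [folklore] -/
theorem add (hφ : CurveDeg D φ) (hψ : CurveDeg D ψ) : CurveDeg D (fun u => φ u + ψ u) := fun n v => by
  obtain ⟨g, hg, hgv⟩ := hφ n v
  obtain ⟨g', hg', hgv'⟩ := hψ n v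
  exact ⟨g + g', (natDegree_add_le _ _).trans (max_le hg hg'), fun t => by
    show φ _ + ψ _ = _; rw [hgv, hgv', eval_add]⟩

/-- Scalar multiples. [folklore] -/
theorem smul (c : K) (hφ : CurveDeg D φ) : CurveDeg D (fun u => c * φ u) := fun n v => by
  obtain ⟨g, hg, hgv⟩ := hφ n v
  exact ⟨C c * g, (natDegree_C_mul_le _ _).trans hg, fun t => by
    show c * φ _ = _; rw [hgv, eval_mul, eval_C]⟩

/-- Finite sums. [folklore] -/
theorem sum {ι : Type*} (s : Finset ι) {f : ι → L → K} (h : ∀ i ∈ s, CurveDeg D (f i)) :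
    CurveDeg D (fun u => ∑ i ∈ s, f i u) := by
  classical
  induction s using Finset.induction_on with
  | empty => simpa using (const (L := L) (0 : K)).mono (Nat.zero_le D)
  | @insert a s ha ih =>
    have h1 : CurveDeg D (fun u => f a u + ∑ i ∈ s, f i u) :=
      (h a (mem_insert_self a s)).add (ih fun i hi => h i (mem_insert_of_mem hi))
    simpa [sum_insert ha] using h1

/-- **Products**: degrees along curves add. [folklore] -/
theorem mul (hφ : CurveDeg D φ) (hψ : CurveDeg D' ψ) : CurveDeg (D + D') (fun u => φ u * ψ u) := fun n v => by
  obtain ⟨g, hg, hgv⟩ := hφ n v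
  obtain ⟨g', hg', hgv'⟩ := hψ n v
  refine ⟨g * g', natDegree_mul_le.trans ?_, fun t => by
    show φ _ * ψ _ = _; rw [hgv, hgv', eval_mul]⟩
  rw [Nat.add_mul]; exact Nat.add_le_add hg hg'

/-- **Finite products**: `|s|` factors of degree `≤ D` give degree `≤ |s| · D`. [folklore] -/
theorem prod {ι : Type*} (s : Finset ι) {f : ι → L → K} (h : ∀ i ∈ s, CurveDeg D (f i)) :
    CurveDeg (s.card * D) (fun u => ∏ i ∈ s, f i u) := by
  classical
  induction s using Finset.induction_on with
  | empty => simpa using const (L := L) (1 : K)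
  | @insert a s ha ih =>
    have h1 : CurveDeg (D + s.card * D) (fun u => f a u * ∏ i ∈ s, f i u) :=
      (h a (mem_insert_self a s)).mul (ih fun i hi => h i (mem_insert_of_mem hi))
    rw [card_insert_of_notMem ha, Nat.succ_mul, Nat.add_comm]
    simpa [prod_insert ha] using h1

/-- **Post-composition with a univariate polynomial** of degree `≤ k` multiplies the degree along
curves by `k`. [folklore] -/
theorem comp_poly (hφ : CurveDeg D φ) {ℓ : K[X]} {k : ℕ} (hℓ : ℓ.natDegree ≤ k) :
    CurveDeg (k * D) (fun u => ℓ.eval (φ u)) := fun n v => by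
  obtain ⟨g, hg, hgv⟩ := hφ n v
  refine ⟨ℓ.comp g, natDegree_comp_le.trans ?_, fun t => by
    show ℓ.eval (φ _) = _; rw [hgv, eval_comp]⟩
  rw [Nat.mul_assoc]
  exact Nat.mul_le_mul hℓ hg

/-- **Pre-composition with a `K`-linear map `L → L` keeps the degree along curves** (the image of
a curve under a linear map is a curve with the same number of coefficients). [cite: Umans2003,
§6.1 ("using property (P1) and the fact that `α` and `σ` are `𝔽_q`-linear maps")] -/
theorem comp_linearMap (hφ : CurveDeg D φ) (A : L →ₗ[K] L) : CurveDeg D (fun u => φ (A u)) := fun n v => by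
  obtain ⟨g, hg, hgv⟩ := hφ n (fun e => A (v e))
  refine ⟨g, hg, fun t => ?_⟩
  show φ (A (curvePt v t)) = _
  rw [← hgv t, linearMap_curvePt]
  rfl

end CurveDeg

/-! ### The grid and the Lagrange (low-degree) extension -/

section Grid

variable [DecidableEq K] {d : ℕ} (B : Module.Basis (Fin d) K L) (H : Finset K)

/-- **The grid point of index `a ∈ H^d`**: `Σ_i a_i • B_i`. [cite: Umans2003, §4.1 (the set
`H^d ⊆ 𝔽_q^d`, identified with `𝔽_{q^d}` through a basis)] -/
def gridPt (a : Fin d → H) : L := ∑ i : Fin d, ((a i : K)) • B i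

omit [DecidableEq K] in
/-- The `B`-coordinates of a grid point. [folklore] -/
theorem coord_gridPt (a : Fin d → H) (i : Fin d) : B.coord i (gridPt B H a) = (a i : K) := by
  rw [gridPt, Module.Basis.coord_apply, Module.Basis.repr_sum_self]

omit [DecidableEq K] in
/-- Grid points of distinct indices are distinct. [folklore] -/
theorem gridPt_injective : Function.Injective (gridPt B H) := by
  intro a a' h
  funext i
  apply Subtype.ext
  have := congrArg (B.coord i) h
  rwa [coord_gridPt, coord_gridPt] at this

/-- **The Lagrange basis polynomial of the node `b ∈ H`**: degree `|H| - 1`, value `1` at `b` and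
`0` at the other nodes. [cite: Umans2003, §4.1, eq. (2) (the factors `Π_{b' ∈ H, b' ≠ b}(y - b')/(b - b')`)] -/
def lagr (b : H) : K[X] := Lagrange.basis H id (b : K)

/-- `lagr b` at the node `b` is `1`. [folklore] -/
theorem eval_lagr_self (b : H) : (lagr H b).eval (b : K) = 1 := by
  rw [lagr]
  exact Lagrange.eval_basis_self (v := id) (Set.injOn_id _) b.2

/-- `lagr b` at another node is `0`. [folklore] -/
theorem eval_lagr_of_ne {b b' : H} (h : b ≠ b') : (lagr H b).eval (b' : K) = 0 := by
  rw [lagr]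
  exact Lagrange.eval_basis_of_ne (v := id) (fun h' => h (Subtype.ext h')) b'.2

/-- `lagr b` has degree `|H| - 1`. [folklore] -/
theorem natDegree_lagr (b : H) : (lagr H b).natDegree = H.card - 1 := by
  rw [lagr]
  exact Lagrange.natDegree_basis (v := id) (Set.injOn_id _) b.2

/-- **The Lagrange extension of a table on the grid** (Umans' `LDE'_x`, eq. (2)):
`u ↦ Σ_{a ∈ H^d} x(a) · Π_i ℓ_{a_i}(u_i)`, `u_i` the `B`-coordinates of `u`.
[cite: Umans2003, §4.1, Thm. 8 and eq. (2)] -/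
def lde (x : (Fin d → H) → K) (u : L) : K :=
  ∑ a : Fin d → H, x a * ∏ i : Fin d, (lagr H (a i)).eval (B.coord i u)

/-- **Interpolation**: the extension takes the value `x(a)` at the grid point of index `a`.
[cite: Umans2003, §4.1, Thm. 8 (property (P2): "`LDE'_x(a^{(i)}) = x_i`")] -/
theorem lde_gridPt (x : (Fin d → H) → K) (a : Fin d → H) : lde B H x (gridPt B H a) = x a := by
  classical
  rw [lde, Finset.sum_eq_single a]
  · simp_rw [coord_gridPt, eval_lagr_self, prod_const_one, mul_one]
  · intro a' _ hne
    obtain ⟨i, hi⟩ : ∃ i, a' i ≠ a i := by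
      by_contra hall
      push Not at hall
      exact hne (funext hall)
    rw [prod_eq_zero (mem_univ i)]
    · rw [mul_zero]
    · rw [coord_gridPt, eval_lagr_of_ne H hi]
  · intro h; exact absurd (mem_univ a) h

/-- **Property (P1): the extension has degree `≤ d (|H| - 1)` along curves** (a sum over the grid
of products of `d` Lagrange polynomials of degree `|H| - 1` in the linear coordinate functionals).
[cite: Umans2003, §4.1, Thm. 8 (property (P1): total degree at most `dh`)] -/
theorem curveDeg_lde (x : (Fin d → H) → K) : CurveDeg (d * (H.card - 1)) (lde B H x) := by
  have h1 : ∀ a : Fin d → H, CurveDeg (d * (H.card - 1))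
      (fun u => ∏ i : Fin d, (lagr H (a i)).eval (B.coord i u)) := fun a => by
    have := CurveDeg.prod (univ : Finset (Fin d)) (D := H.card - 1)
      (f := fun i u => (lagr H (a i)).eval (B.coord i u)) fun i _ => by
        simpa using (CurveDeg.linear (L := L) (B.coord i)).comp_poly (natDegree_lagr H (a i)).le
    simpa using this
  unfold lde
  exact CurveDeg.sum univ fun a _ => CurveDeg.smul (x a) (h1 a)

/-- **A string placed along grid positions.** Given positions `pos k ∈ L` (`k < n`) that are grid
points, the table on the grid carrying `x_k` at the index of `pos k` (and `0` elsewhere).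
[cite: Umans2003, §4.1 ("we embed `x_i` at location `α^{r i}`", the index `a^{(i)}`)] -/
def placedTable {n : ℕ} (pos : Fin n → L) (x : Fin n → K) : (Fin d → H) → K := fun a => by
  classical
  exact if h : ∃ k : Fin n, pos k = gridPt B H a then x (Classical.choose h) else 0

/-- **Property (P2) in the abstract**: if the positions are distinct grid points, the extension of
the placed table reads `x_k` at `pos k`. [cite: Umans2003, §4.1, Thm. 8 (property (P2))] -/
theorem lde_placedTable {n : ℕ} {pos : Fin n → L} (hinj : Function.Injective pos)
    (hgrid : ∀ k, ∃ a, pos k = gridPt B H a) (x : Fin n → K) (k : Fin n) :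
    lde B H (placedTable B H pos x) (pos k) = x k := by
  classical
  obtain ⟨a, ha⟩ := hgrid k
  rw [ha, lde_gridPt, placedTable]
  have hex : ∃ k' : Fin n, pos k' = gridPt B H a := ⟨k, ha⟩
  rw [dif_pos hex]
  congr 1
  exact hinj ((Classical.choose_spec hex).trans ha.symm)

end Grid

/-! ### The Galois-equivariant augmentation -/

section Aug

variable [FiniteDimensional K L]

/-- **Umans' augmented encoding** (Def. 9, sign-corrected, summed over the Galois group): for
`β ∈ L` and `φ : L → K`, `Ẽ(u) = Σ_{τ ∈ Gal(L/K)} φ(τ⁻¹ u) • τ(β)`. With `β` generating a normal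
basis `(τ β)_τ`, the coordinate of `Ẽ(u)` at `τ` is `φ(τ⁻¹ u)`. [cite: Umans2003, §4.2, Def. 9] -/
def augE (β : L) (φ : L → K) (u : L) : L := ∑ τ : Gal(L/K), (φ (τ.symm u)) • τ β

/-- **Property (P3*): equivariance** — `Ẽ(ρ u) = ρ(Ẽ(u))` for every `ρ ∈ Gal(L/K)`, in particular
for the Frobenius `σ` (`σ Ẽ = Ẽ σ`). [cite: Umans2003, §4.2, Thm. 10 (property (P3*))] -/
theorem augE_equivariant (β : L) (φ : L → K) (ρ : Gal(L/K)) (u : L) :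
    augE β φ (ρ u) = ρ (augE β φ u) := by
  unfold augE
  rw [map_sum]
  simp_rw [map_smul]
  -- reindex the left-hand sum by `τ ↦ ρ * τ`
  have key : ∀ x : Gal(L/K),
      (fun τ : Gal(L/K) => φ (τ.symm (ρ u)) • τ β) (Equiv.mulLeft ρ x) = φ (x.symm u) • ρ (x β) := by
    intro x
    simp only [Equiv.coe_mulLeft, AlgEquiv.mul_apply]
    congr 2
    change (ρ * x)⁻¹ (ρ u) = x⁻¹ u
    rw [mul_inv_rev, AlgEquiv.mul_apply]
    simp
  calc ∑ τ : Gal(L/K), φ (τ.symm (ρ u)) • τ β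
      = ∑ x : Gal(L/K), (fun τ : Gal(L/K) => φ (τ.symm (ρ u)) • τ β) (Equiv.mulLeft ρ x) :=
        (Equiv.sum_comp (Equiv.mulLeft ρ) _).symm
    _ = ∑ x : Gal(L/K), φ (x.symm u) • ρ (x β) := sum_congr rfl fun x _ => key x

/-- Iterated equivariance: `Ẽ(ρᵏ u) = ρᵏ(Ẽ(u))`. [cite: Umans2003, §4.2, Thm. 10] -/
theorem augE_equivariant_pow (β : L) (φ : L → K) (ρ : Gal(L/K)) (k : ℕ) (u : L) :
    augE β φ ((ρ ^ k) u) = (ρ ^ k) (augE β φ u) :=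
  augE_equivariant β φ (ρ ^ k) u

/-- **Property (P1*), shape**: a `K`-linear functional of `Ẽ(u)` is the `K`-linear combination
`Σ_τ λ(τ β) · φ(τ⁻¹ u)` of the functions `φ ∘ τ⁻¹`. [cite: Umans2003, §4.2, Thm. 10 (property
(P1*): "`LDE_x σʲ` is a `d`-variate total degree `dh` polynomial if `LDE_x` is")] -/
theorem apply_augE (lam : L →ₗ[K] K) (β : L) (φ : L → K) (u : L) :
    lam (augE β φ u) = ∑ τ : Gal(L/K), lam (τ β) * φ (τ.symm u) := by
  unfold augE
  rw [map_sum]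
  refine sum_congr rfl fun τ _ => ?_
  rw [map_smul, smul_eq_mul, mul_comm]

/-- **Property (P1*)**: every `K`-linear functional of the augmented encoding keeps the degree of
`φ` along curves, for ANY `β` (the `τ⁻¹` are `K`-linear maps of `L`). [cite: Umans2003, §4.2,
Thm. 10 (property (P1*))] -/
theorem curveDeg_apply_augE {D : ℕ} {φ : L → K} (hφ : CurveDeg D φ) (lam : L →ₗ[K] K) (β : L) :
    CurveDeg D (fun u => lam (augE β φ u)) := by
  have h : CurveDeg D (fun u => ∑ τ : Gal(L/K), lam (τ β) * φ (τ.symm u)) :=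
    CurveDeg.sum (univ : Finset Gal(L/K)) fun τ _ =>
      CurveDeg.smul (lam (τ β)) (hφ.comp_linearMap τ.symm.toLinearMap)
  intro n v
  obtain ⟨g, hg, hgv⟩ := h n v
  refine ⟨g, hg, fun t => ?_⟩
  show lam (augE β φ (curvePt v t)) = _
  rw [apply_augE]
  exact hgv t

/-- **Property (P2*): coordinates in a normal basis.** If `N` is a basis of `L / K` indexed by the
Galois group with `N τ = τ β` (a normal basis generated by `β`), the `N`-coordinate of `Ẽ(u)` at `ρ`
is `φ(ρ⁻¹ u)`. [cite: Umans2003, §4.2, Thm. 10 (property (P2*): "`π₀ LDẼ_x = LDE_x`")] -/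
theorem coord_augE (N : Module.Basis Gal(L/K) K L) {β : L} (hN : ∀ τ, N τ = τ β) (φ : L → K) (u : L)
    (ρ : Gal(L/K)) : N.coord ρ (augE β φ u) = φ (ρ.symm u) := by
  unfold augE
  simp_rw [← hN]
  rw [Module.Basis.coord_apply, Module.Basis.repr_sum_self]

/-- **Property (P2*) at the identity**: the coordinate of `Ẽ(u)` at `τ = 1` is `φ(u)` — the
augmented encoding projects back onto the plain one. [cite: Umans2003, §4.2, Thm. 10 (property
(P2*))] -/
theorem coord_one_augE (N : Module.Basis Gal(L/K) K L) {β : L} (hN : ∀ τ, N τ = τ β) (φ : L → K)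
    (u : L) : N.coord 1 (augE β φ u) = φ u := by
  rw [coord_augE N hN]; rfl

/-- **The jump relation behind Umans' §6.3**: for the Frobenius-type automorphism `ρ` and a
position `αⁱ · w`, `Ẽ(ρ(αⁱ w)) = ρ(Ẽ(αⁱ w))` with `ρ(αⁱ w) = ρ(α)ⁱ ρ(w)` — for `ρ = σ`
(`σ α = α^q`) this is "`V_{iq,c+1}` is computed from `V_{i,c}` by applying `σ`".
[cite: Umans2003, §6.3 ("The key consequence of property (P3*)")] -/
theorem augE_mul_pow_equivariant (β : L) (φ : L → K) (ρ : Gal(L/K)) (α w : L) (i : ℕ) :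
    augE β φ (ρ α ^ i * ρ w) = ρ (augE β φ (α ^ i * w)) := by
  rw [← augE_equivariant, map_mul, map_pow]

end Aug

/-! ### The `q^d`-ary generator -/

section Gen

variable [FiniteDimensional K L]

/-- **Umans' `q^d`-ary generator** (Thm. 14, eq. (7)): on the seed `y ∈ L`, output the `m`
symbols `Ẽ(α y), Ẽ(α² y), …, Ẽ(αᵐ y)`. [cite: Umans2003, §5, Thm. 14, eq. (7)] -/
def qGen (β : L) (φ : L → K) (α : L) (m : ℕ) (y : L) : Fin m → L :=
  fun k => augE β φ (α ^ ((k : ℕ) + 1) * y)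

/-- **Shift symmetry of the generator** ("by the symmetry of `G_x` we may assume `i = m`"): the
output on the seed `α y` is the output on `y` shifted by one symbol. [cite: Umans2003, §6 (proof
strategy, "By the symmetry of `G_x`")] -/
theorem qGen_mul (β : L) (φ : L → K) (α : L) (m : ℕ) (y : L) (k : Fin m) :
    qGen β φ α m (α * y) k = augE β φ (α ^ ((k : ℕ) + 2) * y) := by
  rw [qGen, ← mul_assoc, ← pow_succ]

/-- Symbol `k` on the seed `αʲ y` is `Ẽ(α^{j+k+1} y)`. [cite: Umans2003, §6.3 (the values
`V_{i,c}` along the orbit of `α`)] -/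
theorem qGen_pow_mul (β : L) (φ : L → K) (α : L) (m j : ℕ) (y : L) (k : Fin m) :
    qGen β φ α m (α ^ j * y) k = augE β φ (α ^ (j + (k : ℕ) + 1) * y) := by
  rw [qGen, ← mul_assoc, ← pow_add]
  congr 2; ring

end Gen

end UmansEnc

end Literature.Computability.Complexity

end
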